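import Mathlib
import Summits.Ventures.PercRepro2.CutVertexDefs
import Summits.Ventures.PercRepro2.CDCutVertex
import Summits.Ventures.PercRepro2.LeafHalfCrossRed

/-!
# Row (LEAF-½) across a cut vertex, I: side events and the `Q`-mass of a product event
(blind cell PercRepro2, p5 g27; `proofs/P5-OEDGE.md` §35 addendum 1)

Setting: `z` a cut vertex (`CutV.IsCut ends z VA VB EA EB`) with `a₁, b ∈ VA` and `a₂, o, v ∈ VB`.
The events of the row are read on the two sides: `Q = {a₁ ↮ a₂} = (A ∩ C)ᶜ` with
`A = {a₁ ↔ z in A}`, `C = {a₂ ↔ z in B}` (`Q_eq`); `{a₁ ↔ b}` lives on the `A`-side (`connA_eq`,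
`memA`), `{a₂ ↔ o}` on the `B`-side (`connB_eq`, `memB`), `{a₁ ↔ o} = A ∩ {o ↔ z in B}` (`connAB_eq`,
`memAB`) and `{a₂ ↔ b} = {b ↔ z in A} ∩ C` (`connBA_eq`, `memBA`) — all from `CutV.conn_iff_restrict`
and `CutV.conn_across_iff`.  The product law `CutV.prob_sideEvent_inter_eq_mul` then gives the
`Q`-mass of every product event: `P((sA XA ∩ sB XB)ᶜ ∩ (sA S ∩ sB U)) = P_A(S)·P_B(U) − P_A(S ∩ XA)·P_B(U ∩ XB)`
(`prob_Qc_inter`).  The masses of the row are in `CutSideMasses.lean`, the theorem in `CutLeafRow.lean`.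
-/

namespace Summit.Ventures.PercRepro2

open UnionCluster CovForm PendantRoot LeafStep LeafHalfCross

namespace CutLeafRow

variable {V : Type*} {E : Type*} [Fintype E] [DecidableEq E] [Fintype V] [DecidableEq V]
  {R : Type*} [Field R] [LinearOrder R] [IsStrictOrderedRing R]

/-! ## Side events -/

section SideSets

variable {ends : E → Sym2 V} {z : V} {VA VB : Set V} {EA EB : Set E}
  [DecidablePred (· ∈ EA)] [DecidablePred (· ∈ EB)]

omit [Fintype E] [DecidableEq E] [Fintype V] [DecidableEq V] in
/-- Side events intersect inside the side. -/
lemma sideEvent_inter (F : Set E) [DecidablePred (· ∈ F)] (X Y : Set (Config E)) :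
    CutV.sideEvent F X ∩ CutV.sideEvent F Y = CutV.sideEvent F (X ∩ Y) :=
  Set.ext fun _ => Iff.rfl

omit [Fintype E] [DecidableEq E] [Fintype V] [DecidableEq V] in
/-- The sure event read on a side is sure. -/
lemma sideEvent_univ (F : Set E) [DecidablePred (· ∈ F)] :
    CutV.sideEvent F (Set.univ : Set (Config E)) = Set.univ :=
  Set.ext fun _ => by simp [CutV.mem_sideEvent]

omit [Fintype E] [DecidableEq E] [Fintype V] [DecidableEq V] in
/-- `Q = {a₁ ↮ a₂}` across the cut: the complement of `{a₁ ↔ z in A} ∩ {a₂ ↔ z in B}`. -/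
lemma Q_eq (h : CutV.IsCut ends z VA VB EA EB) {a₁ a₂ : V} (ha₁ : a₁ ∈ VA) (ha₂ : a₂ ∈ VB) :
    avoidAll ends a₂ {a₁} =
      (CutV.sideEvent EA (connEvent ends a₁ z) ∩ CutV.sideEvent EB (connEvent ends a₂ z))ᶜ := by
  rw [avoidAll_eq_compl, CutV.connEvent_across_eq h ha₁ ha₂, connEvent_comm ends z a₂]

omit [Fintype E] [DecidableEq E] [Fintype V] [DecidableEq V] [DecidablePred (· ∈ EB)] in
/-- `{a₁ ↔ b}` for `a₁, b ∈ VA` is read on the `A`-side. -/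
lemma connA_eq (h : CutV.IsCut ends z VA VB EA EB) {u w : V} (hu : u ∈ VA) (hw : w ∈ VA) :
    connEvent ends u w = CutV.sideEvent EA (connEvent ends u w) :=
  CutV.connEvent_eq_sideEvent h (Or.inl hu) (Or.inl hw)

omit [Fintype E] [DecidableEq E] [Fintype V] [DecidableEq V] [DecidablePred (· ∈ EA)] in
/-- `{a₂ ↔ o}` for `a₂, o ∈ VB` is read on the `B`-side. -/
lemma connB_eq (h : CutV.IsCut ends z VA VB EA EB) {u w : V} (hu : u ∈ VB) (hw : w ∈ VB) :
    connEvent ends u w = CutV.sideEvent EB (connEvent ends u w) :=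
  CutV.connEvent_eq_sideEvent h.symm (Or.inl hu) (Or.inl hw)

omit [Fintype E] [DecidableEq E] [Fintype V] [DecidableEq V] in
/-- `{a₁ ↔ o}` for `a₁ ∈ VA`, `o ∈ VB`: `{a₁ ↔ z in A} ∩ {o ↔ z in B}`. -/
lemma connAB_eq (h : CutV.IsCut ends z VA VB EA EB) {u w : V} (hu : u ∈ VA) (hw : w ∈ VB) :
    connEvent ends u w =
      CutV.sideEvent EA (connEvent ends u z) ∩ CutV.sideEvent EB (connEvent ends w z) := by
  rw [CutV.connEvent_across_eq h hu hw, connEvent_comm ends z w]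

omit [Fintype E] [DecidableEq E] [Fintype V] [DecidableEq V] in
/-- `{a₂ ↔ b}` for `a₂ ∈ VB`, `b ∈ VA`: `{b ↔ z in A} ∩ {a₂ ↔ z in B}`. -/
lemma connBA_eq (h : CutV.IsCut ends z VA VB EA EB) {u w : V} (hu : u ∈ VB) (hw : w ∈ VA) :
    connEvent ends u w =
      CutV.sideEvent EA (connEvent ends w z) ∩ CutV.sideEvent EB (connEvent ends u z) := by
  rw [CutV.connEvent_across_eq h.symm hu hw, connEvent_comm ends z w, Set.inter_comm]

end SideSets

/-! ## The general mass lemma -/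

section Mass

variable (p : E → R) {ends : E → Sym2 V} {z : V} {VA VB : Set V} {EA EB : Set E}
  [DecidablePred (· ∈ EA)] [DecidablePred (· ∈ EB)]

omit [Fintype V] [DecidableEq V] [LinearOrder R] [IsStrictOrderedRing R] in
/-- **The `Q`-mass of a product event**:
`P((sA XA ∩ sB XB)ᶜ ∩ (sA S ∩ sB U)) = P_A(S)·P_B(U) − P_A(S ∩ XA)·P_B(U ∩ XB)`. -/
theorem prob_Qc_inter (h : CutV.IsCut ends z VA VB EA EB) (XA XB S U : Set (Config E)) :
    prob p ((CutV.sideEvent EA XA ∩ CutV.sideEvent EB XB)ᶜ ∩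
        (CutV.sideEvent EA S ∩ CutV.sideEvent EB U)) =
      prob p (CutV.sideEvent EA S) * prob p (CutV.sideEvent EB U) -
        prob p (CutV.sideEvent EA (S ∩ XA)) * prob p (CutV.sideEvent EB (U ∩ XB)) := by
  have hsplit := prob_inter_add_prob_inter_compl p
    (CutV.sideEvent EA S ∩ CutV.sideEvent EB U) (CutV.sideEvent EA XA ∩ CutV.sideEvent EB XB)
  have e1 : CutV.sideEvent EA S ∩ CutV.sideEvent EB U ∩
      (CutV.sideEvent EA XA ∩ CutV.sideEvent EB XB) =
      CutV.sideEvent EA (S ∩ XA) ∩ CutV.sideEvent EB (U ∩ XB) := by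
    rw [← sideEvent_inter, ← sideEvent_inter]
    ext ω
    simp only [Set.mem_inter_iff]
    tauto
  have e2 : (CutV.sideEvent EA XA ∩ CutV.sideEvent EB XB)ᶜ ∩
      (CutV.sideEvent EA S ∩ CutV.sideEvent EB U) =
      CutV.sideEvent EA S ∩ CutV.sideEvent EB U ∩
        (CutV.sideEvent EA XA ∩ CutV.sideEvent EB XB)ᶜ := Set.inter_comm _ _
  rw [e1, CutV.prob_sideEvent_inter_eq_mul p h, CutV.prob_sideEvent_inter_eq_mul p h] at hsplit
  rw [e2]
  linear_combination hsplit

end Mass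

/-! ## Membership across the cut -/

section Mem

variable {ends : E → Sym2 V} {z : V} {VA VB : Set V} {EA EB : Set E}
  [DecidablePred (· ∈ EA)] [DecidablePred (· ∈ EB)]

omit [Fintype E] [DecidableEq E] [Fintype V] [DecidableEq V] [DecidablePred (· ∈ EB)] in
/-- Membership in `{u ↔ w}`, `u, w ∈ VA`, read on the `A`-side. -/
lemma memA (h : CutV.IsCut ends z VA VB EA EB) {u w : V} (hu : u ∈ VA) (hw : w ∈ VA)
    (ω : Config E) : ω ∈ connEvent ends u w ↔ restrict EA ω ∈ connEvent ends u w :=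
  CutV.conn_iff_restrict h (Or.inl hu) (Or.inl hw)

omit [Fintype E] [DecidableEq E] [Fintype V] [DecidableEq V] [DecidablePred (· ∈ EA)] in
/-- Membership in `{u ↔ w}`, `u, w ∈ VB`, read on the `B`-side. -/
lemma memB (h : CutV.IsCut ends z VA VB EA EB) {u w : V} (hu : u ∈ VB) (hw : w ∈ VB)
    (ω : Config E) : ω ∈ connEvent ends u w ↔ restrict EB ω ∈ connEvent ends u w :=
  CutV.conn_iff_restrict h.symm (Or.inl hu) (Or.inl hw)

omit [Fintype E] [DecidableEq E] [Fintype V] [DecidableEq V] in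
/-- Membership in `{u ↔ w}`, `u ∈ VA`, `w ∈ VB`: `{u ↔ z in A} ∧ {w ↔ z in B}`. -/
lemma memAB (h : CutV.IsCut ends z VA VB EA EB) {u w : V} (hu : u ∈ VA) (hw : w ∈ VB)
    (ω : Config E) : ω ∈ connEvent ends u w ↔
      restrict EA ω ∈ connEvent ends u z ∧ restrict EB ω ∈ connEvent ends w z := by
  rw [mem_connEvent, CutV.conn_across_iff h hu hw, mem_connEvent, mem_connEvent]
  exact ⟨fun ⟨h1, h2⟩ => ⟨h1, conn_symm h2⟩, fun ⟨h1, h2⟩ => ⟨h1, conn_symm h2⟩⟩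

omit [Fintype E] [DecidableEq E] [Fintype V] [DecidableEq V] in
/-- Membership in `{u ↔ w}`, `u ∈ VB`, `w ∈ VA`: `{w ↔ z in A} ∧ {u ↔ z in B}`. -/
lemma memBA (h : CutV.IsCut ends z VA VB EA EB) {u w : V} (hu : u ∈ VB) (hw : w ∈ VA)
    (ω : Config E) : ω ∈ connEvent ends u w ↔
      restrict EA ω ∈ connEvent ends w z ∧ restrict EB ω ∈ connEvent ends u z := by
  rw [mem_connEvent, CutV.conn_across_iff h.symm hu hw, mem_connEvent, mem_connEvent]
  exact ⟨fun ⟨h1, h2⟩ => ⟨conn_symm h2, h1⟩, fun ⟨h1, h2⟩ => ⟨h2, conn_symm h1⟩⟩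

end Mem


end CutLeafRow

end Summit.Ventures.PercRepro2
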